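import Summits.ResolutionOfSingularities.ResolutionOfSingularities.Theorems.PurelyInseparableDim4ComponentThreads
import Summits.ResolutionOfSingularities.ResolutionOfSingularities.Theorems.PurelyInseparableDim4StepKitTrap
import Summits.ResolutionOfSingularities.ResolutionOfSingularities.Theorems.PurelyInseparableDim4ScopeCover
import HarnessLib

/-!
# LOOP-C ‖ K: the COMPONENT-HOPPING region at `(p,q) = (3,3)` — a 6-state region closed for player B in
# the GLOBAL game `Edge` against every maximal-dimensional permissible coordinate component, every state
# IN COORDINATE SCOPE (cell `res-dim4-pi`, seat res-dim4-p-8 g2, WORD #45 (2) / #47 (a)(2))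

[OURS · counted 0 · a kernel certificate of a LOCATED SPECIMEN of this cell (idea-2 g2's LOOP-C, K = B by
eng-w5 g2 · eng-w4 g2 (Singular) · crit-4 V-A4-12 · crit-5 g2 T-A5-01 · crit-1 T-A-07, and re-derived here by a
fourth independent implementation).  A statement about OUR coordinate-centre frame (`PIDim4.Edge`,
`PIDim4.InCoordinateScope`, `ComponentThreads.IsComponent`); NOT about `TerminatesInScope 3 3` in its ∃-rule
form, NOT about the local game (replies over the current point only — there the hop replies below are absent
and nothing is claimed), and nothing here proves or refutes resolution of singularities in dimension `≥ 4` /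
characteristic `p`.]

THE SPECIMEN (idea-2 g2, `hop-g2/README` 5d2a8a98ff2e7317; variables `x₁ … x₄`, `u = 1 + x₃`, over `𝔽₃`):
`t0 = s1 = x₄²u²(x₄² + x₁x₂u²)` has the two maximal-dimensional permissible coordinate components
`V(x₁,x₄)`, `V(x₂,x₄)`; B answers the blow-up of either at the ORIGIN of the `x₁`- resp. `x₂`-chart
(`t1`, `t2 = s2 = x₄²(x₂x₄²u² + x₁u⁴)`); there the component `V(x₂,x₄)` resp. `V(x₁,x₄)` is unique and B
answers with the HOP `b = (0,0,2,1)` ALONG THE CENTRE to `x₃ = 2` (where `1 + x₃ ↦ x₃`; char-3 far plane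
`V(x₃ − 2, x₄)`, crit-1 T-A-07) with fibre coordinate `1`, landing on `t3 = s3`, the `x₃ ↔ x₄` mirror of
`s1`; the mirror half (`t4`, `t5 = s4`, hop `b = (0,0,1,2)`) returns to `t0` LITERALLY (bookkeeping
`r = 0`, `exc = {x₁, x₂}` is stationary on the region).

WHAT IS CERTIFIED (all by `decide` on res-dim4-p-13's presented states, soundness lemmas below):
* §1 Boolean forms of `ComponentThreads.IsComponent` (`componentB`) and of «maximal-dimensional component»
  (`maxDimB` ↔ `IsComponent ∧ least |S| among components`).
* §2 `regionB` — p-13's trap-table format `TrapRows` restricted to the CLASS of maximal-dimensional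
  components (moves checked by p-13's `moveB`) — and its soundness `region_of_regionB`.
* §3 a `decide`-able IN-SCOPE certificate `scopeCertB` by UNIT-MONOMIAL WITNESSES `D^{(α)}F = x^m · U`,
  `U(0) ≠ 0` (every prime `J₃⁺ ≤ P ≤ 𝔪₀` contains a variable of each `x^m`; every coordinate transversal
  `T` of the witnesses has `J₃⁺ ≤ (x_T)`), soundness `inCoordinateScope_of_scopeCertB` over
  `ScopeCover.inCoordinateScope_of_forall_prime`.
* §4 the data `t0 … t5`, `loopC`, `w0 … w5`; §5 the kernel checks; §6 the conclusions
  **`loopC_region`** (closure in `Edge` against every maximal-dimensional component + `3`-fold origins),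
  **`loopC_inScope`**, and the rule-level negative **`exists_inScope_branch_of_maxDimRule`**: over `𝔽₃` every
  coordinate rule that blows up a maximal-dimensional component whenever one exists has an infinite branch of
  in-scope states (hence `¬ TerminatesUnder 3 R`, `not_terminatesUnder_of_maxDimRule`) — idea-2's typed
  `ComponentHopping33` with `IsMaxDimComponentRule` spelled out over `ComponentThreads.IsComponent`.
bears_on: LADDER-RESOLUTION:D157-DOOR2 (res-dim4-pi · F4-C-glob(3,3) · C-LOOP-C LOCATED ‖ K).
Supports stmt-ResolutionOfSingularities-16155 (helper).
-/

set_option linter.dupNamespace false -- mandated namespace of this single-conjunct summit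

noncomputable section

open MvPolynomial Finset
open scoped BigOperators

namespace Summit.ResolutionOfSingularities.ResolutionOfSingularities.Theorems.PIDim4

namespace LoopC

open StepKit ScopeCover ComponentThreads
open Literature.AlgebraicGeometry.Resolution
open Literature.AlgebraicGeometry.Resolution.CentreBlowup

variable {K : Type} [Field K] [DecidableEq K]

/-! ## §1 Components as Boolean checks -/

/-- `q ≤ ord_{(x_S)} (evalT L)` as a Boolean check (no non-emptiness clause). [folklore] -/
def ordGeB (q : ℕ) (S : Finset (Fin 4)) (L : Terms 4 K) : Bool :=
  (live L).all fun e => decide (q ≤ ∑ i ∈ S, e i)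

/-- Transfer of `ordGeB`. [folklore] -/
theorem le_ordAlong_iff_ordGeB (q : ℕ) (S : Finset (Fin 4)) (L : Terms 4 K) :
    (q : ℕ∞) ≤ ordAlong S (evalT L) ↔ ordGeB q S L = true := by
  rw [ordAlong_evalT, le_infList_iff]
  simp only [ordGeB, List.all_eq_true, decide_eq_true_eq, List.mem_map, forall_exists_index, and_imp,
    forall_apply_eq_imp_iff₂, Nat.cast_le]

/-- `ComponentThreads.IsComponent` as a Boolean check: permissible, and no `S ∖ {k}` has order `≥ q`. [folklore] -/
def componentB (q : ℕ) (S : Finset (Fin 4)) (L : Terms 4 K) : Bool :=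
  permB q S L && decide (∀ k ∈ S, ordGeB q (S.erase k) L = false)

/-- Transfer of `componentB`. [folklore] -/
theorem isComponent_iff (q : ℕ) (S : Finset (Fin 4)) (L : Terms 4 K) :
    IsComponent q S (evalT L) ↔ componentB q S L = true := by
  unfold IsComponent
  simp only [componentB, Bool.and_eq_true, decide_eq_true_eq, isPermissibleCentre_iff, le_ordAlong_iff_ordGeB,
    Bool.not_eq_true]

/-- «MAXIMAL-DIMENSIONAL component» (a component of least `|S|`) as a Boolean check. [folklore] -/
def maxDimB (q : ℕ) (S : Finset (Fin 4)) (L : Terms 4 K) : Bool :=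
  componentB q S L && decide (∀ S' : Finset (Fin 4), componentB q S' L = true → S.card ≤ S'.card)

/-- Transfer of `maxDimB`. [folklore] -/
theorem isMaxDim_iff (q : ℕ) (S : Finset (Fin 4)) (L : Terms 4 K) :
    (IsComponent q S (evalT L) ∧ ∀ S', IsComponent q S' (evalT L) → S.card ≤ S'.card) ↔ maxDimB q S L = true := by
  simp only [maxDimB, Bool.and_eq_true, decide_eq_true_eq, isComponent_iff]

/-! ## §2 Regions closed against the class of maximal-dimensional components -/

/-- **Region checker** (p-13's `TrapRows` format, class-restricted): every listed state has a `q`-fold origin,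
SOME maximal-dimensional component, and every maximal-dimensional component is answered by a recorded legal
move (`StepKit.moveB`) back into the list. [folklore] -/
def regionB (q : ℕ) (TW : TrapRows K) : Bool :=
  TW.all fun sw => permB q Finset.univ sw.1.L && decide (∃ S : Finset (Fin 4), maxDimB q S sw.1.L = true) &&
    decide (∀ S : Finset (Fin 4), maxDimB q S sw.1.L = true → ∃ m ∈ sw.2, m.1 = S ∧ moveB q TW sw.1 m = true)

/-- **Soundness of the region checker**: every presented state has a `q`-fold origin, a maximal-dimensional
component, and an `Edge`-reply inside the region to the blow-up of every maximal-dimensional component. [folklore] -/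
theorem region_of_regionB {q : ℕ} {TW : TrapRows K} (h : regionB q TW = true) :
    ∀ s ∈ trapSet TW, (q : ℕ∞) ≤ ordAlong Finset.univ s.F ∧
      (∃ S, IsComponent q S s.F ∧ ∀ S', IsComponent q S' s.F → S.card ≤ S'.card) ∧
      ∀ S, IsComponent q S s.F → (∀ S', IsComponent q S' s.F → S.card ≤ S'.card) →
        ∃ s' ∈ trapSet TW, Edge q S s s' := by
  rintro x ⟨sw, hsw, rfl⟩
  simp only [regionB, List.all_eq_true, Bool.and_eq_true, decide_eq_true_eq] at h
  obtain ⟨⟨hord, ⟨S₀, hS₀⟩⟩, hall⟩ := h sw hsw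
  refine ⟨((isPermissibleCentre_iff q _ sw.1.L).mpr hord).2, ⟨S₀, (isMaxDim_iff q S₀ sw.1.L).mpr hS₀⟩,
    fun S hS hmax => ?_⟩
  obtain ⟨m, -, hmS, hmove⟩ := hall S ((isMaxDim_iff q S sw.1.L).mp ⟨hS, hmax⟩)
  obtain ⟨s', hs', hedge⟩ := edge_of_moveB hmove
  exact ⟨s', hs', hmS ▸ hedge⟩

/-! ## §3 A `decide`-able in-scope certificate by unit-monomial witnesses -/

/-- A **unit-monomial witness** `(α, m)`: `0 < |α| < q`, every non-zero term of `D^{(α)}(evalT L)` is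
divisible by `x^m`, and the coefficient of `x^m` itself is non-zero — so `D^{(α)}F = x^m · U` with
`U(0) ≠ 0`. [folklore] -/
def unitWitnessB (q : ℕ) (L : Terms 4 K) (w : (Fin 4 → ℕ) × (Fin 4 → ℕ)) : Bool :=
  decide (0 < ∑ i, w.1 i) && decide (∑ i, w.1 i < q) &&
    ((hasseL w.1 L).all fun t => decide (t.2 = 0) || decide (∀ i, w.2 i ≤ t.1 i)) &&
    !decide (coeffAt (hasseL w.1 L) w.2 = 0)

/-- The co-factor `U` of a witness, presented: drop zero terms, divide exponents by `x^m`. [folklore] -/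
def downL (m : Fin 4 → ℕ) (H : Terms 4 K) : Terms 4 K :=
  (H.filter fun t => t.2 ≠ 0).map fun t => (fun i => t.1 i - m i, t.2)

/-- Factorisation `evalT H = x^m · evalT (downL m H)` when every non-zero term is divisible by `x^m`. [folklore] -/
theorem evalT_eq_monomial_mul_downL {m : Fin 4 → ℕ} {H : Terms 4 K}
    (h : ∀ t ∈ H, t.2 = 0 ∨ ∀ i, m i ≤ t.1 i) :
    evalT H = monomial (expo m) 1 * evalT (downL m H) := by
  induction H with
  | nil => simp [downL]
  | cons t H ih =>
    have ih' := ih fun t' ht' => h t' (List.mem_cons_of_mem _ ht')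
    rcases h t (by simp) with h0 | hle
    · have : downL m (t :: H) = downL m H := by simp [downL, h0]
      rw [evalT_cons, h0, map_zero, zero_add, this, ih']
    · by_cases ht0 : t.2 = 0
      · have : downL m (t :: H) = downL m H := by simp [downL, ht0]
        rw [evalT_cons, ht0, map_zero, zero_add, this, ih']
      · have : downL m (t :: H) = (fun i => t.1 i - m i, t.2) :: downL m H := by simp [downL, ht0]
        have hexp : expo m + expo (fun i => t.1 i - m i) = expo t.1 := by
          ext i
          rw [Finsupp.add_apply, expo_apply, expo_apply, expo_apply]
          have := hle i; omega
        rw [evalT_cons, this, evalT_cons, mul_add, ← ih', monomial_mul, one_mul, hexp]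

/-- The constant coefficient of the co-factor is the coefficient of `x^m`. [folklore] -/
theorem coeffAt_downL_zero {m : Fin 4 → ℕ} {H : Terms 4 K}
    (h : ∀ t ∈ H, t.2 = 0 ∨ ∀ i, m i ≤ t.1 i) : coeffAt (downL m H) 0 = coeffAt H m := by
  induction H with
  | nil => simp [downL, coeffAt]
  | cons t H ih =>
    have ih' := ih fun t' ht' => h t' (List.mem_cons_of_mem _ ht')
    by_cases ht0 : t.2 = 0
    · have : downL m (t :: H) = downL m H := by simp [downL, ht0]
      rw [this, ih', coeffAt]
      split_ifs <;> simp [ht0]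
    · have hle : ∀ i, m i ≤ t.1 i := (h t (by simp)).resolve_left ht0
      have : downL m (t :: H) = (fun i => t.1 i - m i, t.2) :: downL m H := by simp [downL, ht0]
      rw [this, coeffAt, coeffAt, ih']
      congr 1
      have hiff : ((fun i => t.1 i - m i) = (0 : Fin 4 → ℕ)) ↔ t.1 = m := by
        constructor
        · intro hz; funext i
          have := congrFun hz i; simp only [Pi.zero_apply] at this
          have := hle i; omega
        · rintro rfl; funext i; simp
      by_cases htm : t.1 = m
      · rw [if_pos (hiff.mpr htm), if_pos htm]
      · rw [if_neg (mt hiff.mp htm), if_neg htm]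

/-- **A unit-monomial witness puts a variable of `x^m` into every prime between `J_q⁺` and `𝔪₀`.** [folklore] -/
theorem exists_X_mem_of_unitWitnessB {q : ℕ} {L : Terms 4 K} {w : (Fin 4 → ℕ) × (Fin 4 → ℕ)}
    (hw : unitWitnessB q L w = true) {P : Ideal (MvPolynomial (Fin 4) K)} (hP : P.IsPrime)
    (hJP : singLocusIdeal q (evalT L) ≤ P) (hP0 : P ≤ originIdeal K) :
    ∃ i, 0 < w.2 i ∧ (X i : MvPolynomial (Fin 4) K) ∈ P := by
  classical
  simp only [unitWitnessB, Bool.and_eq_true, decide_eq_true_eq, List.all_eq_true, Bool.or_eq_true,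
    Bool.not_eq_true', decide_eq_false_iff_not] at hw
  obtain ⟨⟨⟨h0, hq⟩, hdiv⟩, hunit⟩ := hw
  set H := hasseL w.1 L with hH
  -- the generator `D^{(α)}F ∈ P`
  have hG : evalT H ∈ P := by
    refine hJP (Ideal.subset_span ⟨expo w.1, ?_, ?_, ?_⟩)
    · rw [degree_expo]; exact h0
    · rw [degree_expo]; exact hq
    · rw [hH, ← hasseDeriv_evalT]
  rw [evalT_eq_monomial_mul_downL hdiv] at hG
  rcases hP.mem_or_mem hG with hm | hU
  · -- `x^m ∈ P`: some variable of `m` lies in `P`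
    have hspan := monomial_mem_span_varsOf hP hP0 hm
    obtain ⟨i, hi, hmi⟩ := MvPolynomial.mem_ideal_span_X_image.mp hspan (expo w.2)
      (by rw [MvPolynomial.mem_support_iff, coeff_monomial, if_pos rfl]; exact one_ne_zero)
    exact ⟨i, Nat.pos_of_ne_zero hmi, hi⟩
  · -- the co-factor is a unit at the origin: contradiction
    exfalso
    have hU0 : evalT (downL w.2 H) ∈ originIdeal K := hP0 hU
    rw [IsolationCert.originIdeal_eq_idealOfVars,
      Literature.RingTheory.MvPolynomial.mem_idealOfVars_iff_constantCoeff_eq_zero] at hU0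
    apply hunit
    rw [← coeffAt_downL_zero hdiv, ← Finsupp.coe_zero, ← coeff_evalT]
    exact hU0

/-- **The in-scope certificate**: unit-monomial witnesses, and for every coordinate set `T` transversal to
them, every live exponent of every `D^{(α)}F` (`0 < |α| < q`) has positive `T`-degree (`J_q⁺ ≤ (x_T)`). [folklore] -/
def scopeCertB (q : ℕ) (L : Terms 4 K) (W : List ((Fin 4 → ℕ) × (Fin 4 → ℕ))) : Bool :=
  W.all (unitWitnessB q L) &&
    decide (∀ T : Finset (Fin 4), (∀ w ∈ W, ∃ i ∈ T, 0 < w.2 i) →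
      ∀ α ∈ idxLT q, ∀ e ∈ live (hasseL α L), ∃ i ∈ T, 0 < e i)

/-- **Soundness of the in-scope certificate**: `InCoordinateScope q (evalT L)`. [folklore] -/
theorem inCoordinateScope_of_scopeCertB {q : ℕ} {L : Terms 4 K} {W : List ((Fin 4 → ℕ) × (Fin 4 → ℕ))}
    (h : scopeCertB q L W = true) : InCoordinateScope q (evalT L) := by
  classical
  simp only [scopeCertB, Bool.and_eq_true, List.all_eq_true, decide_eq_true_eq] at h
  obtain ⟨hW, hT⟩ := h
  refine inCoordinateScope_of_forall_prime fun P hP hJP hP0 => ?_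
  -- the coordinate hull of `P` is transversal to the witnesses
  set T : Finset (Fin 4) := Finset.univ.filter fun i => (X i : MvPolynomial (Fin 4) K) ∈ P with hTdef
  have htrans : ∀ w ∈ W, ∃ i ∈ T, 0 < w.2 i := fun w hw => by
    obtain ⟨i, hi, hXi⟩ := exists_X_mem_of_unitWitnessB (hW w hw) hP hJP hP0
    exact ⟨i, by simp [hTdef, hXi], hi⟩
  have key := hT T htrans
  unfold singLocusIdeal
  rw [Ideal.span_le]
  rintro G ⟨α, h0, hq, rfl⟩
  rw [SetLike.mem_coe, ← expo_coe α, hasseDeriv_evalT]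
  refine MvPolynomial.mem_ideal_span_X_image.mpr fun m' hm' => ?_
  obtain ⟨i, hiT, hi⟩ := key (⇑α) (mem_idxLT h0 hq) (⇑m') ((mem_support_evalT_iff _ m').mp hm')
  refine ⟨i, ?_, Nat.pos_iff_ne_zero.mp hi⟩
  simp only [hTdef, Finset.mem_filter, Finset.mem_univ, true_and] at hiT
  exact hiT

/-- The same for a presented state. [folklore] -/
theorem inCoordinateScope_toState_of_scopeCertB {q : ℕ} {s : SData 4 K}
    {W : List ((Fin 4 → ℕ) × (Fin 4 → ℕ))} (h : scopeCertB q s.L W = true) :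
    InCoordinateScope q s.toState.F :=
  inCoordinateScope_of_scopeCertB h

/-! ## §4 The LOOP-C data (over `𝔽₃`) -/

/-- Region state `t0`: `s1 = x₄²u²(x₄² + x₁x₂u²)`, `u = 1 + x₃` (idea-2's `s1`; components `V(x₁,x₄)`, `V(x₂,x₄)`); bookkeeping `r = 0`, `exc = {x₁, x₂}`. [OURS · specimen] -/
def t0 : SData 4 (ZMod 3) := ⟨[(![0, 0, 0, 4], 1), (![1, 1, 0, 2], 1), (![0, 0, 1, 4], 2), (![1, 1, 1, 2], 1), (![0, 0, 2, 4], 1), (![1, 1, 3, 2], 1), (![1, 1, 4, 2], 1)], ![0, 0, 0, 0], {0, 1}⟩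

/-- Region state `t1`: the `x₁ ↔ x₂` twin of idea-2's `s2` (child of `t0` under `V(x₁,x₄)`, `x₁`-chart, origin; component `V(x₂,x₄)`); bookkeeping `r = 0`, `exc = {x₁, x₂}`. [OURS · specimen] -/
def t1 : SData 4 (ZMod 3) := ⟨[(![0, 1, 0, 2], 1), (![0, 1, 1, 2], 1), (![1, 0, 0, 4], 1), (![0, 1, 3, 2], 1), (![1, 0, 1, 4], 2), (![0, 1, 4, 2], 1), (![1, 0, 2, 4], 1)], ![0, 0, 0, 0], {0, 1}⟩

/-- Region state `t2`: idea-2's `s2 = x₄²(x₂x₄²u² + x₁u⁴)` (child of `t0` under `V(x₂,x₄)`, `x₂`-chart, origin; component `V(x₁,x₄)`); bookkeeping `r = 0`, `exc = {x₁, x₂}`. [OURS · specimen] -/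
def t2 : SData 4 (ZMod 3) := ⟨[(![1, 0, 0, 2], 1), (![1, 0, 1, 2], 1), (![0, 1, 0, 4], 1), (![0, 1, 1, 4], 2), (![1, 0, 3, 2], 1), (![0, 1, 2, 4], 1), (![1, 0, 4, 2], 1)], ![0, 0, 0, 0], {0, 1}⟩

/-- Region state `t3`: idea-2's `s3` = the `x₃ ↔ x₄` mirror of `s1` (reached by the HOP `b = (0,0,2,1)`; components `V(x₁,x₃)`, `V(x₂,x₃)`); bookkeeping `r = 0`, `exc = {x₁, x₂}`. [OURS · specimen] -/
def t3 : SData 4 (ZMod 3) := ⟨[(![0, 0, 4, 0], 1), (![1, 1, 2, 0], 1), (![0, 0, 4, 1], 2), (![1, 1, 2, 1], 1), (![0, 0, 4, 2], 1), (![1, 1, 2, 3], 1), (![1, 1, 2, 4], 1)], ![0, 0, 0, 0], {0, 1}⟩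

/-- Region state `t4`: the `x₁ ↔ x₂` twin of idea-2's `s4` (component `V(x₂,x₃)`); bookkeeping `r = 0`, `exc = {x₁, x₂}`. [OURS · specimen] -/
def t4 : SData 4 (ZMod 3) := ⟨[(![0, 1, 2, 0], 1), (![0, 1, 2, 1], 1), (![1, 0, 4, 0], 1), (![0, 1, 2, 3], 1), (![1, 0, 4, 1], 2), (![0, 1, 2, 4], 1), (![1, 0, 4, 2], 1)], ![0, 0, 0, 0], {0, 1}⟩

/-- Region state `t5`: idea-2's `s4` (component `V(x₁,x₃)`; the HOP `b = (0,0,1,2)` leads back to `t0`); bookkeeping `r = 0`, `exc = {x₁, x₂}`. [OURS · specimen] -/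
def t5 : SData 4 (ZMod 3) := ⟨[(![1, 0, 2, 0], 1), (![1, 0, 2, 1], 1), (![0, 1, 4, 0], 1), (![0, 1, 4, 1], 2), (![1, 0, 2, 3], 1), (![0, 1, 4, 2], 1), (![1, 0, 2, 4], 1)], ![0, 0, 0, 0], {0, 1}⟩

/-- **The LOOP-C region table**: the six states with B's replies `(centre S, chart j, point b, child)` to every
maximal-dimensional permissible coordinate component (two at `t0`/`t3`, one at the others; the replies at
`t1`, `t2` / `t4`, `t5` are the HOPS along the centre). [OURS · specimen · idea-2 g2 LOOP-C + x₁↔x₂ twins] -/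
def loopC : TrapRows (ZMod 3) :=
  [(t0, [({0, 3}, 0, ![0, 0, 0, 0], 1), ({1, 3}, 1, ![0, 0, 0, 0], 2)]),
   (t1, [({1, 3}, 1, ![0, 0, 2, 1], 3)]),
   (t2, [({0, 3}, 0, ![0, 0, 2, 1], 3)]),
   (t3, [({0, 2}, 0, ![0, 0, 0, 0], 4), ({1, 2}, 1, ![0, 0, 0, 0], 5)]),
   (t4, [({1, 2}, 1, ![0, 0, 1, 2], 0)]),
   (t5, [({0, 2}, 0, ![0, 0, 1, 2], 0)])]

/-- In-scope witnesses for `t0`: pairs `(α, m)` with `D^{(α)}F = x^m · unit`. [OURS · certificate data] -/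
def w0 : List ((Fin 4 → ℕ) × (Fin 4 → ℕ)) := [(![0, 0, 0, 2], ![1, 1, 0, 0]), (![0, 0, 2, 0], ![0, 0, 0, 4])]

/-- In-scope witnesses for `t1`: pairs `(α, m)` with `D^{(α)}F = x^m · unit`. [OURS · certificate data] -/
def w1 : List ((Fin 4 → ℕ) × (Fin 4 → ℕ)) := [(![0, 0, 0, 2], ![0, 1, 0, 0]), (![0, 1, 0, 0], ![0, 0, 0, 2])]

/-- In-scope witnesses for `t2`: pairs `(α, m)` with `D^{(α)}F = x^m · unit`. [OURS · certificate data] -/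
def w2 : List ((Fin 4 → ℕ) × (Fin 4 → ℕ)) := [(![0, 0, 0, 2], ![1, 0, 0, 0]), (![0, 1, 0, 0], ![0, 0, 0, 4])]

/-- In-scope witnesses for `t3`: pairs `(α, m)` with `D^{(α)}F = x^m · unit`. [OURS · certificate data] -/
def w3 : List ((Fin 4 → ℕ) × (Fin 4 → ℕ)) := [(![0, 0, 0, 2], ![0, 0, 4, 0]), (![0, 0, 2, 0], ![1, 1, 0, 0])]

/-- In-scope witnesses for `t4`: pairs `(α, m)` with `D^{(α)}F = x^m · unit`. [OURS · certificate data] -/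
def w4 : List ((Fin 4 → ℕ) × (Fin 4 → ℕ)) := [(![0, 0, 2, 0], ![0, 1, 0, 0]), (![0, 1, 0, 0], ![0, 0, 2, 0])]

/-- In-scope witnesses for `t5`: pairs `(α, m)` with `D^{(α)}F = x^m · unit`. [OURS · certificate data] -/
def w5 : List ((Fin 4 → ℕ) × (Fin 4 → ℕ)) := [(![0, 0, 2, 0], ![1, 0, 0, 0]), (![0, 1, 0, 0], ![0, 0, 4, 0])]

/-! ## §5 Kernel checks -/

/-- The region table checks: `3`-fold origins, maximal-dimensional components present, every one answered
inside the table. [OURS · ‖ K] -/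
theorem regionB_loopC : regionB 3 loopC = true := by decide +kernel

/-- `t0` is in coordinate scope (components `V(x₁,x₄)`, `V(x₂,x₄)`). [OURS · ‖ K] -/
theorem scope_t0 : scopeCertB 3 t0.L w0 = true := by decide +kernel
/-- `t1` is in coordinate scope. [OURS · ‖ K] -/
theorem scope_t1 : scopeCertB 3 t1.L w1 = true := by decide +kernel
/-- `t2` is in coordinate scope. [OURS · ‖ K] -/
theorem scope_t2 : scopeCertB 3 t2.L w2 = true := by decide +kernel
/-- `t3` is in coordinate scope. [OURS · ‖ K] -/
theorem scope_t3 : scopeCertB 3 t3.L w3 = true := by decide +kernel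
/-- `t4` is in coordinate scope. [OURS · ‖ K] -/
theorem scope_t4 : scopeCertB 3 t4.L w4 = true := by decide +kernel
/-- `t5` is in coordinate scope. [OURS · ‖ K] -/
theorem scope_t5 : scopeCertB 3 t5.L w5 = true := by decide +kernel

/-! ## §6 Conclusions -/

/-- **LOOP-C, region form (GLOBAL game `Edge`)**: every state of the region has a `3`-fold origin, at least
one maximal-dimensional permissible coordinate component, and for EVERY such component an `Edge`-successor
inside the region. [OURS · ‖ K · located specimen of idea-2 g2] -/
theorem loopC_region : ∀ s ∈ trapSet loopC, (3 : ℕ∞) ≤ ordAlong Finset.univ s.F ∧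
    (∃ S, IsComponent 3 S s.F ∧ ∀ S', IsComponent 3 S' s.F → S.card ≤ S'.card) ∧
    ∀ S, IsComponent 3 S s.F → (∀ S', IsComponent 3 S' s.F → S.card ≤ S'.card) →
      ∃ s' ∈ trapSet loopC, Edge 3 S s s' :=
  region_of_regionB regionB_loopC

/-- **LOOP-C, scope form**: every state of the region is IN COORDINATE SCOPE (its `3`-fold locus through the
origin is a union of coordinate planes). [OURS · ‖ K] -/
theorem loopC_inScope : ∀ s ∈ trapSet loopC, InCoordinateScope 3 s.F := by
  rintro s ⟨sw, hsw, rfl⟩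
  simp only [loopC, List.mem_cons, List.not_mem_nil, or_false] at hsw
  rcases hsw with rfl | rfl | rfl | rfl | rfl | rfl
  · exact inCoordinateScope_toState_of_scopeCertB scope_t0
  · exact inCoordinateScope_toState_of_scopeCertB scope_t1
  · exact inCoordinateScope_toState_of_scopeCertB scope_t2
  · exact inCoordinateScope_toState_of_scopeCertB scope_t3
  · exact inCoordinateScope_toState_of_scopeCertB scope_t4
  · exact inCoordinateScope_toState_of_scopeCertB scope_t5

/-- `t0` presents a member of the region (non-emptiness). [OURS] -/
theorem t0_mem_loopC : t0.toState ∈ trapSet loopC :=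
  ⟨(t0, [({0, 3}, 0, ![0, 0, 0, 0], 1), ({1, 3}, 1, ![0, 0, 0, 0], 2)]), by simp [loopC], rfl⟩

/-- **COMPONENT HOPPING at `(3,3)`, rule form** (idea-2 g2's `ComponentHopping33`, spelled out): over `𝔽₃`,
every coordinate rule that blows up a MAXIMAL-DIMENSIONAL permissible coordinate component whenever one
exists has an infinite branch inside the LOOP-C region — all states in coordinate scope — in the GLOBAL game
`Edge`/`StepRule`. [OURS · ‖ K] -/
theorem exists_inScope_branch_of_maxDimRule (R : CentreRule (ZMod 3))
    (hR : ∀ s : State (ZMod 3),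
      (∃ S, IsComponent 3 S s.F ∧ ∀ S', IsComponent 3 S' s.F → S.card ≤ S'.card) →
        IsComponent 3 (R s) s.F ∧ ∀ S', IsComponent 3 S' s.F → (R s).card ≤ S'.card) :
    ∃ c : ℕ → State (ZMod 3), (∀ k, c k ∈ trapSet loopC) ∧
      ∀ k, InCoordinateScope 3 (c k).F ∧ StepRule 3 R (c k) (c (k + 1)) := by
  have key : ∀ s : trapSet loopC, ∃ s' : trapSet loopC, StepRule 3 R s s' := by
    rintro ⟨s, hs⟩
    obtain ⟨-, hex, hall⟩ := loopC_region s hs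
    obtain ⟨hcomp, hmin⟩ := hR s hex
    obtain ⟨s', hs', hedge⟩ := hall (R s) hcomp hmin
    exact ⟨⟨s', hs'⟩, hcomp.1, hedge⟩
  choose f hf using key
  refine ⟨fun k => ((f^[k] ⟨t0.toState, t0_mem_loopC⟩ : trapSet loopC) : State (ZMod 3)),
    fun k => (f^[k] ⟨t0.toState, t0_mem_loopC⟩).2, fun k => ⟨loopC_inScope _ (f^[k] _).2, ?_⟩⟩
  show StepRule 3 R ((f^[k] _ : trapSet loopC) : State (ZMod 3)) ((f^[k + 1] _ : trapSet loopC) : State (ZMod 3))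
  rw [Function.iterate_succ_apply']
  exact hf _

/-- Hence no such rule terminates over `𝔽₃` (`PIDim4.TerminatesUnder`), although every state it visits from
`t0` stays in coordinate scope — a negative about the CLASS of maximal-dimensional-component rules in the
global game only. [OURS · ‖ K] -/
theorem not_terminatesUnder_of_maxDimRule (R : CentreRule (ZMod 3))
    (hR : ∀ s : State (ZMod 3),
      (∃ S, IsComponent 3 S s.F ∧ ∀ S', IsComponent 3 S' s.F → S.card ≤ S'.card) →
        IsComponent 3 (R s) s.F ∧ ∀ S', IsComponent 3 S' s.F → (R s).card ≤ S'.card) :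
    ¬ TerminatesUnder 3 R := by
  intro hterm
  obtain ⟨c, -, hc⟩ := exists_inScope_branch_of_maxDimRule R hR
  exact hterm ⟨c, fun k => (hc k).2⟩

end LoopC

end Summit.ResolutionOfSingularities.ResolutionOfSingularities.Theorems.PIDim4

end
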